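import Summits.NavierStokesRegularity.FunctionalMining.TopEigGapCutoffPowDeriv
import HarnessLib

/-!
# FunctionalMining — L-λ(η) at a general exponent `q ≥ 2`: the cut-off flux `F^δ_{q,k} = H_δ(λ₁)∂ₖλ₁`,
# the cut-off channel density `cutDensityPow`, and the pointwise comparison on the top-gap class

Search for candidate a priori estimates; no regularity claim. Cell `pub-nsfunc`, prove seat
(gen 26). Sequel of `TopEigGapCutoffPowDeriv` (objects `cutPow`, `cutProjPow`, `cutFluxPow`, `cutDensityPow`
and the projector-field bound `sum_sq_partialDeriv_cutProjPow_le_of_gap`). With `H = cutPow δ q`,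
`H' = cutPowDeriv δ q`, `A = topDiagSq`, `R = topChannelW`, at a simple point `x`:

* `partialDeriv_cutFluxPow_eq`, **`sum_partialDeriv_cutFluxPow_eq`**: `∑ₖ ∂ₖF^δ_{q,k}(x) = H'(λ₁)A + H(λ₁)(μ(S;S(Δv)) + 2R)`
  (product rule along coordinate lines, `∑ₖ∂ₖ∂ₖλ₁ = Δλ₁`, the R-form of `Δλ₁`);
* `cutDensityPow_eq_of_simple` (`= 2H'A + 4HR`), `cutDensityPow_eq_zero_of_lt` (`= 0` where `λ₁ < δ`),
  `partialDeriv_cutProjPow_eq_zero_of_lt`;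
* **`sum_sq_partialDeriv_cutProjPow_le_cutDensityPow`** — on the top-gap class `λ₂ ≤ (1−η)λ₁`
  (`0 < η ≤ 1`, `2 ≤ q`, `δ > 0`), at EVERY point:
  `∑ₖ∑ᵢⱼ (∂ₖ M^δ_qᵢⱼ(x))² ≤ ((q−1)/(2η)) · λ₁(x)^{q−2} · cutDensityPow δ q v x`; `cutDensityPow_nonneg`.

[ours]
-/

noncomputable section

open Filter Topology Matrix Finset MeasureTheory
open scoped ContDiff

namespace Summit.NavierStokesRegularity.FunctionalMining

open Literature.Analysis Literature.Analysis.FunctionSpaces Literature.Analysis.FunctionSpaces.Torus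
  SharpClass.DirectorForm Literature.Analysis.Matrix

namespace TopEig

variable {v : UnitAddTorus (Fin 3) → EuclideanSpace ℝ (Fin 3)}


/-! ## 1. The cut-off flux at a simple point -/

/-- **`∂ₖ F^δ_{q,k}(x) = H'(λ₁) a_k² + H(λ₁) ∂ₖ∂ₖλ₁(x)`** at a simple point. [ours] -/
theorem partialDeriv_cutFluxPow_eq (hv : Torus.IsSmooth v) (hdiv : Torus.IsDivFree v) (δ q : ℝ)
    {x : UnitAddTorus (Fin 3)} (hx : torusStrainMidEig v x < torusStrainTopEig v x) (k : Fin 3) :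
    Torus.partialDeriv k (cutFluxPow δ q v k) x =
      cutPowDeriv δ q (torusStrainTopEig v x) *
          (topVec v x ⬝ᵥ (torusStrainMatrix (Torus.partialDeriv k v) x *ᵥ topVec v x)) ^ 2 +
        cutPow δ q (torusStrainTopEig v x) *
          Torus.partialDeriv k (Torus.partialDeriv k (torusStrainTopEig v)) x := by
  have hG := hasDerivAt_cutPow_topEig_coordLine hv hdiv δ q hx k
  have hD := hasDerivAt_coordLine_of_contDiffAt (contDiffAt_liftAt_partialDeriv_topEig_of_simple hv hx k) k
  have hHF : Torus.partialDeriv k (torusStrainTopEig v) x =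
      topVec v x ⬝ᵥ (torusStrainMatrix (Torus.partialDeriv k v) x *ᵥ topVec v x) := by
    rw [← ofLp_eigenvectorBasis_topIndex]
    exact (partialDeriv_partialDeriv_torusStrainTopEig_eq_sum_frame hv hx (eigenvalues_topIndex v x) k).1
  have h := hG.mul hD
  have hval : Torus.partialDeriv k (torusStrainTopEig v)
      (x + proj ((0 : ℝ) • EuclideanSpace.single k (1 : ℝ))) =
      topVec v x ⬝ᵥ (torusStrainMatrix (Torus.partialDeriv k v) x *ᵥ topVec v x) := by
    rw [coordLine_zero, hHF]
  have hG0 : cutPow δ q (torusStrainTopEig v (x + proj ((0 : ℝ) • EuclideanSpace.single k (1 : ℝ)))) =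
      cutPow δ q (torusStrainTopEig v x) := by rw [coordLine_zero]
  rw [hval, hG0] at h
  have h' : HasDerivAt (fun t : ℝ => cutFluxPow δ q v k (x + proj (t • EuclideanSpace.single k (1 : ℝ))))
      (cutPowDeriv δ q (torusStrainTopEig v x) *
          (topVec v x ⬝ᵥ (torusStrainMatrix (Torus.partialDeriv k v) x *ᵥ topVec v x)) *
          (topVec v x ⬝ᵥ (torusStrainMatrix (Torus.partialDeriv k v) x *ᵥ topVec v x)) +
        cutPow δ q (torusStrainTopEig v x) *
          Torus.partialDeriv k (Torus.partialDeriv k (torusStrainTopEig v)) x) 0 := h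
  show deriv (fun t : ℝ => cutFluxPow δ q v k (x + proj (t • EuclideanSpace.single k (1 : ℝ)))) 0 = _
  rw [h'.deriv]
  ring

/-- **`∑ₖ ∂ₖ F^δ_{q,k}(x) = H'(λ₁) A + H(λ₁) (μ(S;S(Δv)) + 2 R)`** at a simple point. [ours] -/
theorem sum_partialDeriv_cutFluxPow_eq (hv : Torus.IsSmooth v) (hdiv : Torus.IsDivFree v) (δ q : ℝ)
    {x : UnitAddTorus (Fin 3)} (hx : torusStrainMidEig v x < torusStrainTopEig v x) :
    ∑ k, Torus.partialDeriv k (cutFluxPow δ q v k) x =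
      cutPowDeriv δ q (torusStrainTopEig v x) * topDiagSq v x +
        cutPow δ q (torusStrainTopEig v x) *
          (dirTopEig (StrainL4.strainFlat v x) (StrainL4.strainFlat (Torus.laplacian v) x) +
            2 * topChannelW v x) := by
  simp_rw [partialDeriv_cutFluxPow_eq hv hdiv δ q hx]
  rw [Finset.sum_add_distrib, ← Finset.mul_sum, ← Finset.mul_sum]
  have hlap : ∑ k, Torus.partialDeriv k (Torus.partialDeriv k (torusStrainTopEig v)) x =
      Torus.laplacian (torusStrainTopEig v) x :=
    (laplacian_eq_sum_partialDeriv_partialDeriv_of_contDiffAt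
      ((contDiffAt_liftAt_torusStrainTopEig_of_midEig_lt hv hx).of_le (by norm_cast))).symm
  obtain ⟨he1, hSe, hgap⟩ := gapForm_eigenvectorBasis hx (eigenvalues_topIndex v x)
  have hg : 0 < torusStrainTopEig v x - torusStrainMidEig v x := sub_pos.2 hx
  have hμ := dirTopEig_strainFlat_eq_of_gapForm he1 hSe hg hgap (Torus.laplacian v)
  have hR := laplacian_torusStrainTopEig_eq_sum_frame hv hx (eigenvalues_topIndex v x)
  rw [ofLp_eigenvectorBasis_topIndex] at hμ hR
  rw [hlap, hR, hμ]
  unfold topDiagSq topChannelW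
  rfl

/-! ## 2. The cut-off channel density at exponent `q` -/

/-- **At a simple point, `cutDensityPow δ q v x = 2 H'(λ₁) A + 4 H(λ₁) R`.** [ours] -/
theorem cutDensityPow_eq_of_simple (hv : Torus.IsSmooth v) (hdiv : Torus.IsDivFree v) (δ q : ℝ)
    {x : UnitAddTorus (Fin 3)} (hx : torusStrainMidEig v x < torusStrainTopEig v x) :
    cutDensityPow δ q v x =
      2 * cutPowDeriv δ q (torusStrainTopEig v x) * topDiagSq v x +
        4 * cutPow δ q (torusStrainTopEig v x) * topChannelW v x := by
  unfold cutDensityPow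
  rw [sum_partialDeriv_cutFluxPow_eq hv hdiv δ q hx]
  ring

/-- **Where `λ₁(x) < δ`, `cutDensityPow δ q v x = 0`.** [ours] -/
theorem cutDensityPow_eq_zero_of_lt (hv : Torus.IsSmooth v) {δ : ℝ} (hδ : 0 < δ) (q : ℝ)
    {x : UnitAddTorus (Fin 3)} (hx : torusStrainTopEig v x < δ) : cutDensityPow δ q v x = 0 := by
  unfold cutDensityPow
  have h0 : ∀ k, Torus.partialDeriv k (cutFluxPow δ q v k) x = 0 := by
    intro k
    have e : cutFluxPow δ q v k = fun y => cutRamp δ (torusStrainTopEig v y) *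
        (torusStrainTopEig v y ^ (q - 2) * Torus.partialDeriv k (torusStrainTopEig v) y) := by
      funext y; simp only [cutFluxPow, cutPow, mul_assoc]
    rw [e]
    exact partialDeriv_cutRamp_topEig_mul_eq_zero hv hδ _ hx k
  simp_rw [h0]
  rw [Finset.sum_const_zero, cutPow_of_le hδ hx.le]
  ring

/-- Where `λ₁(x) < δ`, every `∂ₖ M^δ_qᵢⱼ(x) = 0`. [ours, bookkeeping] -/
theorem partialDeriv_cutProjPow_eq_zero_of_lt (hv : Torus.IsSmooth v) {δ : ℝ} (hδ : 0 < δ) (q : ℝ)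
    {x : UnitAddTorus (Fin 3)} (hx : torusStrainTopEig v x < δ) (k i j : Fin 3) :
    Torus.partialDeriv k (cutProjPow δ q v i j) x = 0 := by
  have e : cutProjPow δ q v i j = fun y => cutRamp δ (torusStrainTopEig v y) *
      (torusStrainTopEig v y ^ (q - 2) * topProj v y i j) := by
    funext y; simp only [cutProjPow, cutPow, mul_assoc]
  rw [e]
  exact partialDeriv_cutRamp_topEig_mul_eq_zero hv hδ _ hx k

/-- **THE POINTWISE COMPARISON AT EXPONENT `q` ON THE TOP-GAP CLASS.** For `v` smooth and divergence free
on `T³`, `2 ≤ q`, `0 < η ≤ 1`, `δ > 0`, `λ₂ ≤ (1−η)λ₁` everywhere, at EVERY point `x`: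
`∑ₖ∑ᵢⱼ (∂ₖ M^δ_qᵢⱼ(x))² ≤ ((q−1)/(2η)) · λ₁(x)^{q−2} · cutDensityPow δ q v x`. [ours] -/
theorem sum_sq_partialDeriv_cutProjPow_le_cutDensityPow (hv : Torus.IsSmooth v) (hdiv : Torus.IsDivFree v)
    {δ q η : ℝ} (hq : 2 ≤ q) (hδ : 0 < δ) (hη0 : 0 < η) (hη1 : η ≤ 1)
    (hgap : ∀ x : UnitAddTorus (Fin 3), torusStrainMidEig v x ≤ (1 - η) * torusStrainTopEig v x)
    (x : UnitAddTorus (Fin 3)) :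
    ∑ k, ∑ i, ∑ j, (Torus.partialDeriv k (cutProjPow δ q v i j) x) ^ 2 ≤
      (q - 1) / (2 * η) * torusStrainTopEig v x ^ (q - 2) * cutDensityPow δ q v x := by
  by_cases hlt : torusStrainTopEig v x < δ
  · simp_rw [partialDeriv_cutProjPow_eq_zero_of_lt hv hδ q hlt]
    rw [cutDensityPow_eq_zero_of_lt hv hδ q hlt]
    simp
  · have hx := simple_of_le_topEig_of_gap hη0 hδ hgap x (not_lt.1 hlt)
    have h1 := sum_sq_partialDeriv_cutProjPow_le_of_gap (δ := δ) hv hdiv hq hη0 hx (hgap x)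
    rw [cutDensityPow_eq_of_simple hv hdiv δ q hx]
    have hlam0 : 0 < torusStrainTopEig v x := topEig_pos_of_simple hv hdiv hx
    have hL0 : 0 ≤ torusStrainTopEig v x ^ (q - 2) := Real.rpow_nonneg hlam0.le _
    have hA0 := topDiagSq_nonneg v x
    have hR0 := topChannelW_nonneg hx
    have hg0 : 0 ≤ cutPowDeriv δ q (torusStrainTopEig v x) := cutPowDeriv_nonneg hq hlam0
    have hG0 : 0 ≤ cutPow δ q (torusStrainTopEig v x) := cutPow_nonneg q hlam0.le
    set L := torusStrainTopEig v x ^ (q - 2)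
    set gA := cutPowDeriv δ q (torusStrainTopEig v x) * topDiagSq v x
    set GR := cutPow δ q (torusStrainTopEig v x) * topChannelW v x
    have hgA : 0 ≤ gA := mul_nonneg hg0 hA0
    have hGR : 0 ≤ GR := mul_nonneg hG0 hR0
    -- `h1 : LHS ≤ L * ((q−1) gA + (2/η) GR)`; target `((q−1)/(2η)) L (2 gA + 4 GR)`
    have e1 : torusStrainTopEig v x ^ (q - 2) *
        ((q - 1) * cutPowDeriv δ q (torusStrainTopEig v x) * topDiagSq v x +
          2 / η * cutPow δ q (torusStrainTopEig v x) * topChannelW v x) = L * ((q - 1) * gA + 2 / η * GR) := by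
      simp only [L, gA, GR]; ring
    have e2 : (q - 1) / (2 * η) * torusStrainTopEig v x ^ (q - 2) *
        (2 * cutPowDeriv δ q (torusStrainTopEig v x) * topDiagSq v x +
          4 * cutPow δ q (torusStrainTopEig v x) * topChannelW v x) =
        L * ((q - 1) / η * gA + 2 * (q - 1) / η * GR) := by
      simp only [L, gA, GR]; field_simp; ring
    rw [e1] at h1
    rw [e2]
    have hq1 : 1 ≤ q - 1 := by linarith
    have hc1 : (q - 1) * gA ≤ (q - 1) / η * gA := by
      have : q - 1 ≤ (q - 1) / η := by
        rw [le_div_iff₀ hη0]; nlinarith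
      exact mul_le_mul_of_nonneg_right this hgA
    have hc2 : 2 / η * GR ≤ 2 * (q - 1) / η * GR := by
      have : 2 / η ≤ 2 * (q - 1) / η := by
        rw [div_le_div_iff_of_pos_right hη0]; nlinarith
      exact mul_le_mul_of_nonneg_right this hGR
    calc ∑ k, ∑ i, ∑ j, (Torus.partialDeriv k (cutProjPow δ q v i j) x) ^ 2
        ≤ L * ((q - 1) * gA + 2 / η * GR) := h1
      _ ≤ L * ((q - 1) / η * gA + 2 * (q - 1) / η * GR) :=
          mul_le_mul_of_nonneg_left (add_le_add hc1 hc2) hL0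

/-- On the top-gap class (`2 ≤ q`, `0 < η`, `δ > 0`), **`0 ≤ cutDensityPow δ q v x` at every point**.
[ours] -/
theorem cutDensityPow_nonneg (hv : Torus.IsSmooth v) (hdiv : Torus.IsDivFree v)
    {δ q η : ℝ} (hq : 2 ≤ q) (hδ : 0 < δ) (hη0 : 0 < η)
    (hgap : ∀ x : UnitAddTorus (Fin 3), torusStrainMidEig v x ≤ (1 - η) * torusStrainTopEig v x)
    (x : UnitAddTorus (Fin 3)) : 0 ≤ cutDensityPow δ q v x := by
  by_cases hlt : torusStrainTopEig v x < δ
  · rw [cutDensityPow_eq_zero_of_lt hv hδ q hlt]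
  · have hx := simple_of_le_topEig_of_gap hη0 hδ hgap x (not_lt.1 hlt)
    rw [cutDensityPow_eq_of_simple hv hdiv δ q hx]
    have hlam0 : 0 < torusStrainTopEig v x := topEig_pos_of_simple hv hdiv hx
    have hA0 := topDiagSq_nonneg v x
    have hR0 := topChannelW_nonneg hx
    have hg0 : 0 ≤ cutPowDeriv δ q (torusStrainTopEig v x) := cutPowDeriv_nonneg hq hlam0
    have hG0 : 0 ≤ cutPow δ q (torusStrainTopEig v x) := cutPow_nonneg q hlam0.le
    positivity

end TopEig

end Summit.NavierStokesRegularity.FunctionalMining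

end
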